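import Summits.CriticalPhenomena.PercolationContinuityZ3.Theses.PercBudgetLadder
import Summits.CriticalPhenomena.PercolationContinuityZ3.Theorems.PinholeClosing.Negative.PinholeClosingResistance
import Literature.Probability.Percolation.MinOpenCut

/-!
# Crux idea `pocket-resampling-liveness-mass` — first lemmas (crux-ideate r2, ideator 5)

Sketch only: definitions + statements that elaborate; the one real proof is the glue
`pinholeClosing_of_sameShape` (same-shape decrement at every level ⇒ the crux BY NAME).

Objects.  For the window `box 3 n → ∂ⁱⁿ box 3 m` (`m = l n`):
* `openBdry ω A`   — number of ω-open lattice edges with exactly one endpoint in `A`;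
* `IsTightPocket k n m ω A` — `A` is a MINIMAL admissible set (`box n ⊆ A ⊆ box m ∖ ∂ⁱⁿ box m`)
  with `≤ k+1` open boundary edges: every admissible proper subset has `≥ k+2`.  This event is
  LOCAL (it reads only `ω ∩ edgesTouching A`), and on `{budget = k+1}` there is exactly one tight
  pocket (the source side of the source-nearest minimum cut); two distinct tight pockets force
  `budget ≤ k` (submodularity of `openBdry`).
* `hybrid A ω ω'` — `ω` on the edges touching `A`, `ω'` elsewhere ("resample the exterior of A");
* `revival k n m A ω = P_{ω'}(hybrid A ω ω' has budget exactly k+1)` — the probability that a fresh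
  exterior makes `A` THE live pocket;
* `livenessMass k n m ω = Σ_{A tight pocket of ω} revival …` — the liveness mass `D(ω)`.
The lever: `E[D] = P(budget = k+1)` (Fubini + locality + uniqueness) and
`E[D ; budget ≤ k] ≥ (1-(1-(1-p_c)^5)^{k+1}) · P(budget = k+1)` (a fresh exterior kills a door at
bounded cost, the door being located for free by the pocket), whence
`P(budget ≤ k) ≥ (const · P(budget = k+1))² / E[D²]`.
-/

namespace Summit.CriticalPhenomena.PercolationContinuityZ3.Cruxes.PinholeClosing.PocketResampling

open MeasureTheory Finset
open Literature.Probability.Percolation Literature.Probability.LatticeModels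
open Summit.CriticalPhenomena.PercolationContinuityZ3.Theses
open scoped Classical

noncomputable section

/-- The critical bond measure on ℤ³. -/
abbrev μc : Measure (BondConfig (Site 3)) := bondPercolation (zdGraph 3) (criticalProbI 3)

/-- Budget-`k` blocked event of `box 3 n → ∂ⁱⁿ box 3 m` (verbatim the route's inlined event). -/
def bEv (k n m : ℕ) : Set (BondConfig (Site 3)) :=
  {ω | ∃ S : Finset (Sym2 (Site 3)), S.card ≤ k ∧ ¬ ∃ x ∈ box 3 n,
    ∃ y ∈ innerBoundary (zdGraph 3) (box 3 m), (ω \ ↑S) ∈ openConnIn ↑(box 3 m) x y}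

/-- Budget exactly `k+1`. -/
def exactEv (k n m : ℕ) : Set (BondConfig (Site 3)) := bEv (k + 1) n m \ bEv k n m

/-- Open edge-boundary count `c_ω(A)`. -/
def openBdry (ω : BondConfig (Site 3)) (A : Finset (Site 3)) : ℕ :=
  ((edgeBoundary (zdGraph 3) A).filter (· ∈ ω)).card

/-- Admissible source sets of the window: contain the source box, avoid the sink sphere. -/
def Admissible (n m : ℕ) (A : Finset (Site 3)) : Prop :=
  box 3 n ⊆ A ∧ A ⊆ box 3 m \ innerBoundary (zdGraph 3) (box 3 m)

/-- `A` is a TIGHT (minimal) `(k+1)`-pocket of `ω`. -/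
def IsTightPocket (k n m : ℕ) (ω : BondConfig (Site 3)) (A : Finset (Site 3)) : Prop :=
  Admissible n m A ∧ openBdry ω A ≤ k + 1 ∧
    ∀ A' : Finset (Site 3), Admissible n m A' → A' ⊂ A → k + 2 ≤ openBdry ω A'

/-- The hybrid configuration: `ω` on the edges touching `A`, `ω'` on all other edges. -/
def hybrid (A : Finset (Site 3)) (ω ω' : BondConfig (Site 3)) : BondConfig (Site 3) :=
  (ω ∩ ↑(edgesTouching (zdGraph 3) A)) ∪ (ω' \ ↑(edgesTouching (zdGraph 3) A))

/-- Revival probability `λ(A, ω)`: a fresh exterior makes the budget exactly `k+1`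
(then `A` is automatically the unique tight pocket of the hybrid). -/
def revival (k n m : ℕ) (A : Finset (Site 3)) (ω : BondConfig (Site 3)) : ℝ :=
  μc.real {ω' | hybrid A ω ω' ∈ exactEv k n m}

/-- The liveness mass `D(ω) = Σ_{A tight} λ(A, ω)` (a finite sum: `A ⊆ box 3 m`). -/
def livenessMass (k n m : ℕ) (ω : BondConfig (Site 3)) : ℝ :=
  ∑ A ∈ (box 3 m).powerset with IsTightPocket k n m ω A, revival k n m A ω

/-! ## First lemmas of the line (statements) -/

/-- (L0, locality) `IsTightPocket` reads only the edges touching `A`. -/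
def TightPocketLocal : Prop :=
  ∀ (k n m : ℕ) (A : Finset (Site 3)) (ω ω' : BondConfig (Site 3)),
    ω ∩ ↑(edgesTouching (zdGraph 3) A) = ω' ∩ ↑(edgesTouching (zdGraph 3) A) →
    (IsTightPocket k n m ω A ↔ IsTightPocket k n m ω' A)

/-- (L1, uniqueness) on `{budget = k+1}` (lattice configurations) there is exactly one tight
pocket. -/
def TightPocketUnique : Prop :=
  ∀ (k n m : ℕ) (ω : BondConfig (Site 3)), ω ⊆ (zdGraph 3).edgeSet → ω ∈ exactEv k n m →
    ∃! A : Finset (Site 3), IsTightPocket k n m ω A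

/-- (L2, the chain lemma) two distinct tight pockets force the decrement at the SAME shape:
`c(A ∩ B) ≥ k+2` by minimality, so `c(A ∪ B) ≤ k` by submodularity. -/
def TwoPocketsDecrement : Prop :=
  ∀ (k n m : ℕ) (ω : BondConfig (Site 3)) (A B : Finset (Site 3)), ω ⊆ (zdGraph 3).edgeSet →
    IsTightPocket k n m ω A → IsTightPocket k n m ω B → A ≠ B → ω ∈ bEv k n m

/-- (L3, liveness identity) `E[D] = P(budget = k+1)` — Fubini over the product measure, L0, L1. -/
def LivenessIdentity : Prop :=
  ∀ (k n l : ℕ), 2 ≤ l → 1 ≤ n →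
    ∫ ω, livenessMass k n (l * n) ω ∂μc = μc.real (exactEv k n (l * n))

/-- (L4, kill inequality) resampling the exterior of the live pocket closes the `≤ 5` fresh edges at
a door vertex `b` with probability `≥ (1-p_c)^5`; then `A ∪ {b}` has `≤ k` open boundary edges and lies in
`box(ln) ⊆ box(2ln - 1)`, so the budget of the DOUBLED window is `≤ k` (of the same window too, unless `b`
is a sink vertex). -/
def KillInequality : Prop :=
  ∀ (k n l : ℕ), 2 ≤ l → 1 ≤ n →
    (1 - (1 - (1 - (criticalProbI 3 : ℝ)) ^ 5) ^ (k + 1)) * μc.real (exactEv k n (l * n)) ≤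
      ∫ ω in bEv k n (2 * l * n), livenessMass k n (l * n) ω ∂μc

/-- (L5, THE BET) uniform second moment of the liveness mass. -/
def SecondMomentLiveness (k : ℕ) : Prop :=
  ∀ l : ℕ, 2 ≤ l → ∃ K : ℝ, ∀ n : ℕ, 1 ≤ n → ∫ ω, (livenessMass k n (l * n) ω) ^ 2 ∂μc ≤ K

/-- Same-shape decrement at level `k` (budget `k+1` at aspect `l` w.p. `c` ⇒ budget `k` at the SAME
aspect w.p. `c'`), the conclusion of the lever; stronger than level `k` of the crux. -/
def SameShapeDecrement (k : ℕ) : Prop :=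
  ∀ (l : ℕ) (c : ℝ), 2 ≤ l → 0 < c → ∃ c' : ℝ, 0 < c' ∧ ∀ n : ℕ, 1 ≤ n →
    c ≤ μc.real (bEv (k + 1) n (l * n)) → c' ≤ μc.real (bEv k n (l * n))

/-- Level `k` of the crux (premise at `(n, ln)`, conclusion at `(n, 2ln)`), over `bEv`. -/
def LevelStep (k : ℕ) : Prop :=
  ∀ (l : ℕ) (c : ℝ), 2 ≤ l → 0 < c → ∃ c' : ℝ, 0 < c' ∧ ∀ n : ℕ, 1 ≤ n →
    c ≤ μc.real (bEv (k + 1) n (l * n)) → c' ≤ μc.real (bEv k n (2 * l * n))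

/-- The arithmetic of the lever (statement): L2–L5 give level `k`, with
`c' = min(c/2, (q' c/2)² / (4K))`, `q' = 1-(1-(1-p_c)^5)^{k+1}`, by
`P(bEv k n 2ln) ≥ max(q' P(exact) - t, t²/E[D²])`, `t = E[D; D > 1]` (Cauchy–Schwarz + L2). -/
def LeverComposition (k : ℕ) : Prop :=
  TwoPocketsDecrement → LivenessIdentity → KillInequality → SecondMomentLiveness k → LevelStep k

/-! ## Glue (proved): the levels are the crux by name; same-shape decrement is stronger -/

theorem pinholeClosing_of_levels (h : ∀ k, LevelStep k) : PercBudgetLadder.PinholeClosing :=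
  fun k l c hl hc => h k l c hl hc

theorem levelStep_of_sameShape {k : ℕ} (h : SameShapeDecrement k) : LevelStep k := by
  intro l c hl hc
  obtain ⟨c', hc', H⟩ := h l c hl hc
  refine ⟨c', hc', fun n hn hprem => (H n hn hprem).trans ?_⟩
  exact Theorems.PinholeClosing.Negative.blockProb_mono_aspect (k := k) (by nlinarith) (by nlinarith)

theorem pinholeClosing_of_sameShape (h : ∀ k, SameShapeDecrement k) :
    PercBudgetLadder.PinholeClosing := by
  intro k l c hl hc
  obtain ⟨c', hc', H⟩ := h k l c hl hc
  refine ⟨c', hc', fun n hn hprem => ?_⟩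
  have h1 : c' ≤ μc.real (bEv k n (l * n)) := H n hn hprem
  have h2 : μc.real (bEv k n (l * n)) ≤ μc.real (bEv k n (2 * l * n)) :=
    Theorems.PinholeClosing.Negative.blockProb_mono_aspect (k := k) (by nlinarith) (by nlinarith)
  exact h1.trans h2

/-! ## Proved pieces of L2: the cut property of admissible sets -/

/-- Paths of `ω ∖ S` inside the window that start in `A` stay in `A` when every open boundary
edge of `A` lies in `S` (lattice configurations). -/
theorem stays_of_boundary_subset {A : Finset (Site 3)} {ω : BondConfig (Site 3)}
    {S : Finset (Sym2 (Site 3))} {m : ℕ} (hω : ω ⊆ (zdGraph 3).edgeSet)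
    (hS : ∀ e ∈ edgeBoundary (zdGraph 3) A, e ∈ ω → e ∈ S)
    (u v : (↑(box 3 m) : Set (Site 3)))
    (huv : ((openGraph (ω \ ↑S)).induce (↑(box 3 m) : Set (Site 3))).Reachable u v)
    (hu : (u : Site 3) ∈ A) : (v : Site 3) ∈ A := by
  rw [SimpleGraph.reachable_iff_reflTransGen] at huv
  induction huv with
  | refl => exact hu
  | @tail b c _ hbc ih =>
    simp only [SimpleGraph.induce_adj, openGraph_adj, Set.mem_sdiff, Finset.mem_coe] at hbc
    obtain ⟨⟨hopen, hnotS⟩, _⟩ := hbc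
    by_contra hc
    exact hnotS (hS _ ((mem_edgeBoundary_iff).2
      ⟨hω hopen, ⟨(b : Site 3), ih, Sym2.mem_mk_left _ _⟩, ⟨(c : Site 3), hc, Sym2.mem_mk_right _ _⟩⟩)
      hopen)

/-- **Cut property.** The open boundary edges of an admissible set form a blocking set: if
`A` is admissible with `≤ k` open boundary edges then the window is blocked at budget `k`
(lattice configurations). With submodularity of `openBdry` this yields `TwoPocketsDecrement`. -/
theorem mem_bEv_of_openBdry_le {k n m : ℕ} {ω : BondConfig (Site 3)} {A : Finset (Site 3)}
    (hω : ω ⊆ (zdGraph 3).edgeSet) (hA : Admissible n m A) (hk : openBdry ω A ≤ k) :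
    ω ∈ bEv k n m := by
  refine ⟨(edgeBoundary (zdGraph 3) A).filter (· ∈ ω), hk, ?_⟩
  rintro ⟨x, hx, y, hy, hxS, hyS, hr⟩
  have hS : ∀ e ∈ edgeBoundary (zdGraph 3) A, e ∈ ω →
      e ∈ (edgeBoundary (zdGraph 3) A).filter (· ∈ ω) :=
    fun e he heω => Finset.mem_filter.2 ⟨he, heω⟩
  have hyA : y ∈ A := stays_of_boundary_subset hω hS ⟨x, hxS⟩ ⟨y, hyS⟩ hr (hA.1 hx)
  have hy' := hA.2 hyA
  rw [Finset.mem_sdiff] at hy'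
  exact hy'.2 hy

/-- Submodularity of the open edge-boundary count (the cut function of the open graph);
standard, proved for the same objects in the first-drop Sketch of ideator 1-g2 (`cutSubmodular`). -/
def OpenBdrySubmodular : Prop :=
  ∀ (ω : BondConfig (Site 3)) (A B : Finset (Site 3)),
    openBdry ω (A ∩ B) + openBdry ω (A ∪ B) ≤ openBdry ω A + openBdry ω B

/-- **L2 from submodularity** (proved): two distinct tight pockets force the decrement at the
same shape — `A ∩ B` is an admissible proper subset of one of them, so it has `≥ k+2` open
boundary edges, hence `A ∪ B` has `≤ k`, and the cut property applies. -/
theorem twoPocketsDecrement_of_submodular (hsub : OpenBdrySubmodular) : TwoPocketsDecrement := by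
  intro k n m ω A B hω hA hB hne
  have hadmU : Admissible n m (A ∪ B) :=
    ⟨hA.1.1.trans Finset.subset_union_left, Finset.union_subset hA.1.2 hB.1.2⟩
  have hadmI : Admissible n m (A ∩ B) :=
    ⟨Finset.subset_inter hA.1.1 hB.1.1, Finset.inter_subset_left.trans hA.1.2⟩
  have hI : k + 2 ≤ openBdry ω (A ∩ B) := by
    by_cases h : A ⊆ B
    · -- then `A ⊂ B` is an admissible proper subset of the tight pocket `B`: impossible
      have hss : A ⊂ B := Finset.ssubset_iff_subset_ne.2 ⟨h, hne⟩
      have h1 := hB.2.2 A hA.1 hss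
      have h2 := hA.2.1
      omega
    · have hss : A ∩ B ⊂ A :=
        Finset.ssubset_iff_subset_ne.2 ⟨Finset.inter_subset_left, fun heq => h (Finset.inter_eq_left.1 heq)⟩
      exact hA.2.2 _ hadmI hss
  have hU : openBdry ω (A ∪ B) ≤ k := by
    have h1 := hsub ω A B
    have h2 := hA.2.1
    have h3 := hB.2.1
    omega
  exact mem_bEv_of_openBdry_le hω hadmU hU

/-! ## Submodularity of `openBdry` (proved) -/

/-- Boundary membership of a lattice edge `s(x,y)` in terms of its endpoints. -/
theorem mk_mem_edgeBoundary_iff {X : Finset (Site 3)} {x y : Site 3}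
    (hxy : s(x, y) ∈ (zdGraph 3).edgeSet) :
    s(x, y) ∈ edgeBoundary (zdGraph 3) X ↔ (x ∈ X ∧ y ∉ X) ∨ (x ∉ X ∧ y ∈ X) := by
  rw [mem_edgeBoundary_iff]
  simp only [Sym2.mem_iff]
  constructor
  · rintro ⟨-, ⟨v, hv, rfl | rfl⟩, ⟨w, hw, rfl | rfl⟩⟩ <;> tauto
  · rintro (⟨hx, hy⟩ | ⟨hx, hy⟩)
    · exact ⟨hxy, ⟨x, hx, Or.inl rfl⟩, ⟨y, hy, Or.inr rfl⟩⟩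
    · exact ⟨hxy, ⟨y, hy, Or.inr rfl⟩, ⟨x, hx, Or.inl rfl⟩⟩

/-- The open-boundary indicator of an edge. -/
def χ (ω : BondConfig (Site 3)) (X : Finset (Site 3)) (e : Sym2 (Site 3)) : ℕ :=
  if e ∈ ω ∧ e ∈ edgeBoundary (zdGraph 3) X then 1 else 0

/-- Pointwise submodularity of the boundary indicator (16-case truth table). -/
theorem χ_submodular (ω : BondConfig (Site 3)) (A B : Finset (Site 3)) (e : Sym2 (Site 3)) :
    χ ω (A ∩ B) e + χ ω (A ∪ B) e ≤ χ ω A e + χ ω B e := by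
  induction e using Sym2.ind with
  | _ x y =>
    by_cases he : s(x, y) ∈ (zdGraph 3).edgeSet
    · by_cases hω : s(x, y) ∈ ω
      · simp only [χ, hω, true_and, mk_mem_edgeBoundary_iff he, Finset.mem_inter, Finset.mem_union]
        by_cases hxA : x ∈ A <;> by_cases hyA : y ∈ A <;> by_cases hxB : x ∈ B <;>
          by_cases hyB : y ∈ B <;> simp [hxA, hyA, hxB, hyB]
      · simp [χ, hω]
    · have h0 : ∀ X : Finset (Site 3), χ ω X s(x, y) = 0 := fun X => by
        simp only [χ, ite_eq_right_iff, one_ne_zero, imp_false, not_and]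
        intro _ hb
        exact he ((mem_edgeBoundary_iff).1 hb).1
      simp [h0]

/-- `openBdry` as a sum of indicators over any finset of edges containing the boundary. -/
theorem openBdry_eq_sum {ω : BondConfig (Site 3)} {X : Finset (Site 3)} {T : Finset (Sym2 (Site 3))}
    (hT : edgeBoundary (zdGraph 3) X ⊆ T) : openBdry ω X = ∑ e ∈ T, χ ω X e := by
  unfold openBdry χ
  rw [Finset.sum_ite, Finset.sum_const_zero, add_zero, Finset.sum_const, smul_eq_mul, mul_one]
  congr 1
  ext e
  simp only [Finset.mem_filter]
  constructor
  · rintro ⟨hb, hω⟩; exact ⟨hT hb, hω, hb⟩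
  · rintro ⟨-, hω, hb⟩; exact ⟨hb, hω⟩

theorem edgeBoundary_subset_edgesTouching_of_subset {X Y : Finset (Site 3)} (h : X ⊆ Y) :
    edgeBoundary (zdGraph 3) X ⊆ edgesTouching (zdGraph 3) Y := by
  intro e he
  rw [mem_edgeBoundary_iff] at he
  rw [mem_edgesTouching_iff]
  obtain ⟨hE, ⟨v, hv, hve⟩, -⟩ := he
  exact ⟨hE, v, h hv, hve⟩

/-- **Submodularity of the open edge-boundary count** (proved). -/
theorem openBdry_submodular : OpenBdrySubmodular := by
  intro ω A B
  set T := edgesTouching (zdGraph 3) (A ∪ B)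
  rw [openBdry_eq_sum (T := T) (edgeBoundary_subset_edgesTouching_of_subset Finset.inter_subset_union),
    openBdry_eq_sum (T := T) (edgeBoundary_subset_edgesTouching_of_subset subset_rfl),
    openBdry_eq_sum (T := T) (edgeBoundary_subset_edgesTouching_of_subset Finset.subset_union_left),
    openBdry_eq_sum (T := T) (edgeBoundary_subset_edgesTouching_of_subset Finset.subset_union_right),
    ← Finset.sum_add_distrib, ← Finset.sum_add_distrib]
  exact Finset.sum_le_sum fun e _ => χ_submodular ω A B e

/-- **L2, fully proved**: two distinct tight pockets force the decrement. -/
theorem twoPocketsDecrement : TwoPocketsDecrement :=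
  twoPocketsDecrement_of_submodular openBdry_submodular

/-- **Uniqueness half of L1 (proved):** at exact level `k+1` two tight pockets coincide. -/
theorem tightPocket_unique {k n m : ℕ} {ω : BondConfig (Site 3)} {A B : Finset (Site 3)}
    (hω : ω ⊆ (zdGraph 3).edgeSet) (hex : ω ∈ exactEv k n m)
    (hA : IsTightPocket k n m ω A) (hB : IsTightPocket k n m ω B) : A = B := by
  by_contra hne
  exact hex.2 (twoPocketsDecrement k n m ω A B hω hA hB hne)

/-- Hence the liveness mass exceeds `1` only on `{budget ≤ k}`: if two distinct tight pockets
exist the configuration is already in `bEv k` (this is how `D > 1 ⇒ budget ≤ k` is used). -/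
theorem mem_bEv_of_two_tightPockets {k n m : ℕ} {ω : BondConfig (Site 3)} {A B : Finset (Site 3)}
    (hω : ω ⊆ (zdGraph 3).edgeSet) (hA : IsTightPocket k n m ω A) (hB : IsTightPocket k n m ω B)
    (hne : A ≠ B) : ω ∈ bEv k n m :=
  twoPocketsDecrement k n m ω A B hω hA hB hne

end

end Summit.CriticalPhenomena.PercolationContinuityZ3.Cruxes.PinholeClosing.PocketResampling
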